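import Literature.Probability.Percolation.WernerPivotalEstimates
import Literature.Probability.Percolation.WernerCorrelationLengthProofs
import Literature.Probability.Percolation.OneArmLSW
import Mathlib.Analysis.SpecialFunctions.Log.Deriv
import Mathlib.Analysis.Calculus.Deriv.MeanValue
import HarnessLib

/-!
# Werner's Lecture 6: from Lemma 6.2, Lemma 6.3 and the one-arm differential inequality to `β = 5/36` (proofs only)

Topic `Literature/Probability/Percolation`; family `crit-perc`, statement **crit-perc.S16**
(`Literature.Probability.Percolation.triTheta_exponent`: `θ(p) = (p - 1/2)^{5/36 + o(1)}` as
`p ↓ 1/2` for site percolation on the triangular lattice; Smirnov–Werner, *Math. Res. Lett.* **8**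
(2001), §2, Theorem 1 (i) of arXiv:math/0109120, via Kesten, *Comm. Math. Phys.* **109** (1987)).
Sibling PROOF file of `WernerPivotalEstimates.lean` (no new definition, no new named fact), which
records the three constituents of W. Werner, *Lectures on two-dimensional critical percolation*
(IAS/Park City Math. Ser. 16, 2009; arXiv:0710.0856), Lecture 6, §5:

* (A) `Werner2009_lemma62P` — Lemma 6.2 as printed: `d/dp h_p(n) ≍ n² π̂_p(n)` uniformly for
  `n ≤ L(p)`, with the pivotal sum `Σ_x P_p(x pivotal for H(n))` (`paraPivotalSum`) for
  `d/dp h_p(n)` and the four-arm probability `π̂_p(n)` (`fourArmProbAt`) at the SAME parameter;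
* (B) `Werner2009_lemma63` — Lemma 6.3: `π̂_{p'}(n) ≍ π̂_{1/2}(n)` below `L`;
* (C) `Werner2009_oneArm_logDeriv` — p. 47, last display: `|d/dp log P_p(0 ↔ ∂Λ_n)| ≤ c n² π̂_p(n)`,
  in pivotal form `Σ_x P_p(x pivotal for {0 ↔ ∂Λ_n}) ≤ c n² π̂_p(n) P_p(0 ↔ ∂Λ_n)`.

## What is proved here

* `Werner2009_lemma62W_of_lemma62P_of_lemma63` — (A) with (B) is the composite pivotal count
  `Werner2009_lemma62W` of `WernerCorrelationLength.lean` ("Lemma 6.2 combined with Lemma 6.3":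
  `Σ_x P_p(x pivotal for H(n)) ≍ n² π̂_p(n) ≍ n² π̂_{1/2}(n)`), a two-line bookkeeping of constants.
* `hasDerivAt_real_triOneArm` — **Russo's formula for the one-arm event**:
  `d/dq P_q(0 ↔ ∂Λ_N) = Σ_{v ∈ Λ_N} P_q(v pivotal for {0 ↔ ∂Λ_N})` (`oneArmPivotalSum`), the tree's
  `site_russo_formula_sum` (`SiteRusso.lean`) for the increasing event `triOneArm N` determined by
  the sites of `Λ_N` (`isUpperSet_triOneArm`, `determinedBy_triOneArm`, `NearCriticalScaling.lean`);
  `real_triOneArm_pos` — `P_t(0 ↔ ∂Λ_N) > 0` for `t ≥ 1/2`; `exists_pos_le_critOneArmProb` — a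
  positive lower bound for the finitely many `π₁(N)`, `N < n`.
* `Werner2009_oneArm_nearCritical_of_logDeriv` — **(A) with (C) imply the one-arm stability
  `Werner2009_oneArm_nearCritical`** (Werner, p. 48: "It follows that
  `P_p(0 ↔ ∂Λ_n) ≍ P_{1/2}(0 ↔ ∂Λ_n)` for `n ≤ L(p)`"). The printed step is an integration in `p`;
  we integrate exactly as Werner does for Lemma 6.3 ("`|d/dp log π̂_p(n)| ≤ cst d/dp h_p(n)`. If we
  integrate this relation from `p = 1/2` to `p'` …"): by (C) and the lower bound of (A),
  `d/dt log P_t(0 ↔ ∂Λ_N) ≤ c N² π̂_t(N) ≤ K · d/dt h_t(N)` for `t ∈ (1/2, p)` and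
  `n₁ ≤ N ≤ L(p, ε) ≤ L(t, ε)` (`charLengthW_antitone`), so that
  `t ↦ K h_t(N) - log P_t(0 ↔ ∂Λ_N)` is non-decreasing on `[1/2, p]` (`monotoneOn_of_deriv_nonneg`)
  and `log P_p(0 ↔ ∂Λ_N) - log P_{1/2}(0 ↔ ∂Λ_N) ≤ K (h_p(N) - h_{1/2}(N)) ≤ K`. The finitely many
  `N < n₁` are absorbed in the constant, and the lower inequality is monotonicity in `p`. Neither
  (B) nor Kesten's relation is used for this step.
* `triTheta_exponent_of_leavesP` — **crit-perc.S16 from `oneArm_exponent`, `fourArm_exponent`,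
  (A), (B), (C)**, through `triTheta_exponent_of_leavesW` (`WernerCorrelationLengthProofs.lean`).
  After this file the statement rests on five named facts that are each printed lemmas: the two
  critical arm exponents (Lawler–Schramm–Werner 2002, Thm. 1.1; Smirnov–Werner 2001, Thm. 4 of the
  arXiv version, `j = 4`) and Werner's Lemma 6.2, Lemma 6.3 and one-arm differential inequality
  (Kesten's near-critical theory: arm separation and a priori half-plane/wedge estimates, Werner
  §3–§4, Nolin 2008 §4–§6).

## References

* W. Werner, *Lectures on two-dimensional critical percolation*, IAS/Park City Math. Ser. 16
  (2009), Lecture 6, §5: Lemma 6.2 and its proof (first display, Russo's formula), Cor. 6.3,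
  the display `|d/dp log π̂_p(n)| ≤ cst d/dp h_p(n)` and Lemma 6.3, the display
  `|d/dp log P_p(0 ↔ ∂Λ_n)| ≤ c n² π̂_p(n)` (p. 47) and "It follows that
  `P_p(0 ↔ ∂Λ_n) ≍ P_{1/2}(0 ↔ ∂Λ_n)` for `n ≤ L(p)`" (p. 48) [WernerPCMI2009].
* S. Smirnov, W. Werner, Critical exponents for two-dimensional percolation, *Math. Res. Lett.* 8
  (2001) 729–744, §2, Thm. 1 (i) and the paragraph following it [SmirnovWernerMRL2001].
* H. Kesten, Scaling relations for 2D-percolation, *Comm. Math. Phys.* 109 (1987) 109–156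
  [KestenScalingCMP1987].
* L. Russo, On the critical percolation probabilities, *Z. Wahrsch.* 56 (1981), §4, Lemma 3
  [RussoZW1981].

Mathlib: `HasDerivAt.log`, `monotoneOn_of_deriv_nonneg`, `Real.exp_log`, `Set.projIcc`. Tree:
`site_russo_formula_sum` (`SiteRusso.lean`), `isUpperSet_triOneArm`, `determinedBy_triOneArm`,
`critOneArmProb_le_real_triOneArm` (`NearCriticalScaling.lean`), `triOneArm_pos`
(`OneArmLSW.lean`), `hasDerivAt_triLRCrossingProb_two`, `charLengthW_antitone`,
`max_symm_eq_self_of_half_le`, `triTheta_exponent_of_leavesW` (`WernerCorrelationLengthProofs.lean`),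
`fourArmProbAt_nonneg` (`WernerPivotalEstimates.lean`).
-/

noncomputable section

open Filter Topology MeasureTheory Set
open scoped unitInterval

namespace Literature.Probability.Percolation

open LatticeModels

/-! ### (A) with (B): the composite pivotal count -/

/-- **Lemma 6.2 combined with Lemma 6.3** (Werner 2009, Lecture 6, §5): the pivotal estimate at
the running parameter, `Σ_x P_t(x pivotal for H(N)) ≍ N² π̂_t(N)` (`Werner2009_lemma62P`), and the
four-arm stability `π̂_t(N) ≍ π̂_{1/2}(N)` (`Werner2009_lemma63`), both for `n₁ ≤ N ≤ L(t, ε)`, give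
the composite `Σ_x P_t(x pivotal for H(N)) ≍ N² π̂_{1/2}(N)` (`Werner2009_lemma62W`), with the
product constants. [cite: WernerPCMI2009, Lecture 6, Lemma 6.2 and Lemma 6.3] -/
theorem Werner2009_lemma62W_of_lemma62P_of_lemma63 (hA : Werner2009_lemma62P)
    (hB : Werner2009_lemma63) : Werner2009_lemma62W := by
  obtain ⟨εA, hεA, hA⟩ := hA
  obtain ⟨εB, hεB, hB⟩ := hB
  refine ⟨min εA εB, lt_min hεA hεB, fun ε hε hεlt => ?_⟩
  obtain ⟨rA, hrA⟩ := hA hε (hεlt.trans_le (min_le_left _ _))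
  obtain ⟨rB, hrB⟩ := hB hε (hεlt.trans_le (min_le_right _ _))
  refine ⟨max rA rB, fun r₀ hr₀ => ?_⟩
  obtain ⟨nA, δA, hδA, cA, hcA, CA, hbA⟩ := hrA r₀ ((le_max_left _ _).trans hr₀)
  obtain ⟨nB, δB, hδB, cB, hcB, CB, hbB⟩ := hrB r₀ ((le_max_right _ _).trans hr₀)
  refine ⟨max nA nB, min δA δB, lt_min hδA hδB, cA * cB, mul_pos hcA hcB, max CA 0 * max CB 0,
    fun t ht1 ht2 N hN hNL => ?_⟩
  have htA : (t : ℝ) < 1 / 2 + δA := by linarith [min_le_left δA δB]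
  have htB : (t : ℝ) < 1 / 2 + δB := by linarith [min_le_right δA δB]
  obtain ⟨hA1, hA2⟩ := hbA t ht1 htA N ((le_max_left _ _).trans hN) hNL
  obtain ⟨hB1, hB2⟩ := hbB t ht1 htB N ((le_max_right _ _).trans hN) hNL
  have hπ0 : 0 ≤ critFourArmProb r₀ N := measureReal_nonneg
  have hπt0 : 0 ≤ fourArmProbAt t r₀ N := fourArmProbAt_nonneg t r₀ N
  have hN0 : (0 : ℝ) ≤ (N : ℝ) ^ 2 := sq_nonneg _
  constructor
  · calc cA * cB * ((N : ℝ) ^ 2 * critFourArmProb r₀ N)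
        = cA * ((N : ℝ) ^ 2 * (cB * critFourArmProb r₀ N)) := by ring
      _ ≤ cA * ((N : ℝ) ^ 2 * fourArmProbAt t r₀ N) := by gcongr
      _ ≤ paraPivotalSum t N := hA1
  · calc paraPivotalSum t N ≤ CA * ((N : ℝ) ^ 2 * fourArmProbAt t r₀ N) := hA2
      _ ≤ max CA 0 * ((N : ℝ) ^ 2 * fourArmProbAt t r₀ N) := by gcongr; exact le_max_left _ _
      _ ≤ max CA 0 * ((N : ℝ) ^ 2 * (max CB 0 * critFourArmProb r₀ N)) := by
          have h4 : fourArmProbAt t r₀ N ≤ max CB 0 * critFourArmProb r₀ N :=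
            hB2.trans (mul_le_mul_of_nonneg_right (le_max_left _ _) hπ0)
          exact mul_le_mul_of_nonneg_left (mul_le_mul_of_nonneg_left h4 hN0) (le_max_right _ _)
      _ = max CA 0 * max CB 0 * ((N : ℝ) ^ 2 * critFourArmProb r₀ N) := by ring

/-! ### Russo's formula and positivity for the one-arm probability -/

/-- **Russo's formula for the one-arm event** (Werner 2009, Lecture 6, §5, "Using differential
inequalities for the one-arm event" with the first display of the proof of Lemma 6.2,
`d/dp h_p(n) = Σ_x P_p(x is pivotal)`; Russo 1981, §4, Lemma 3): for `q ∈ (0, 1)`,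
`d/dq P_q(0 ↔ ∂Λ_N) = Σ_{v ∈ Λ_N} P_q(v pivotal for {0 ↔ ∂Λ_N})` (`oneArmPivotalSum`; the real
parameter is clamped to `[0, 1]` by `Set.projIcc`, the convention of `site_russo_formula_sum`).
[cite: WernerPCMI2009, Lecture 6, §5 ("Using differential inequalities for the one-arm event")] [cite: RussoZW1981, §4 Lemma 3 (4.2)] -/
theorem hasDerivAt_real_triOneArm (N : ℕ) {q : ℝ} (hq : q ∈ Ioo (0 : ℝ) 1) :
    HasDerivAt
      (fun r : ℝ => (triSitePercolation (projIcc (0 : ℝ) 1 zero_le_one r)).real (triOneArm N))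
      (oneArmPivotalSum (projIcc (0 : ℝ) 1 zero_le_one q) N) q :=
  site_russo_formula_sum (isUpperSet_triOneArm N) (triBall N) (determinedBy_triOneArm N) hq

/-- `P_t(0 ↔ ∂Λ_N) > 0` for `t ≥ 1/2`: at `1/2` an open segment realises the arm
(`triOneArm_pos`), and the one-arm probability is non-decreasing in the parameter
(`critOneArmProb_le_real_triOneArm`). [folklore] -/
theorem real_triOneArm_pos {t : unitInterval} (ht : 1 / 2 ≤ (t : ℝ)) (N : ℕ) :
    0 < (triSitePercolation t).real (triOneArm N) := by
  have h0 : 0 < critOneArmProb N := triOneArm_pos N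
  have hle : half ≤ t := Subtype.coe_le_coe.1 (by rw [coe_half]; exact ht)
  exact h0.trans_le (critOneArmProb_le_real_triOneArm hle N)

/-- A common positive lower bound for the finitely many critical one-arm probabilities `π₁(N)`,
`N < n` (each is positive, `triOneArm_pos`). [folklore] -/
theorem exists_pos_le_critOneArmProb (n : ℕ) :
    ∃ m > (0 : ℝ), ∀ N < n, m ≤ critOneArmProb N := by
  induction n with
  | zero => exact ⟨1, one_pos, fun N hN => absurd hN (Nat.not_lt_zero N)⟩
  | succ n ih =>
    obtain ⟨m, hm, h⟩ := ih
    have hpos : 0 < critOneArmProb n := triOneArm_pos n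
    refine ⟨min m (critOneArmProb n), lt_min hm hpos, fun N hN => ?_⟩
    rcases Nat.lt_succ_iff_lt_or_eq.1 hN with hlt | rfl
    · exact (min_le_left _ _).trans (h N hlt)
    · exact min_le_right _ _

/-! ### (A) with (C): the one-arm stability below `L(p)` -/

/-- **Integration of the one-arm differential inequality at one scale** (Werner 2009, Lecture 6,
§5, pp. 47–48: from `|d/dp log P_p(0 ↔ ∂Λ_n)| ≤ c n² π̂_p(n)` "It follows that
`P_p(0 ↔ ∂Λ_n) ≍ P_{1/2}(0 ↔ ∂Λ_n)` for `n ≤ L(p)`", integrating as for Lemma 6.3). Abstract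
form: if `1/2 < p < 1`, `P_t(0 ↔ ∂Λ_N) > 0` on `[1/2, p]`, and for every `t ∈ (1/2, p)` the one-arm
pivotal sum is at most `K` times the pivotal sum of `h_t(N)` times `P_t(0 ↔ ∂Λ_N)`, then
`P_p(0 ↔ ∂Λ_N) ≤ e^K · P_{1/2}(0 ↔ ∂Λ_N)`: the function `t ↦ K h_t(N) - log P_t(0 ↔ ∂Λ_N)` has a
nonnegative derivative on `(1/2, p)` (Russo's formula for both events), hence
`log P_p - log P_{1/2} ≤ K (h_p(N) - h_{1/2}(N)) ≤ K`. [cite: WernerPCMI2009, Lecture 6, §5 (pp. 47–48, "It follows that …")] -/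
theorem real_triOneArm_le_exp_mul_of_pivotal {p : unitInterval} (hp : 1 / 2 < (p : ℝ))
    (hp1 : (p : ℝ) < 1) {N : ℕ} {K : ℝ} (hK : 0 ≤ K)
    (hpiv : ∀ t : unitInterval, 1 / 2 < (t : ℝ) → t < p →
      oneArmPivotalSum t N ≤ K * paraPivotalSum t N * (triSitePercolation t).real (triOneArm N)) :
    (triSitePercolation p).real (triOneArm N) ≤ Real.exp K * critOneArmProb N := by
  -- the two probabilities as functions of a real parameter
  set f : ℝ → ℝ := fun r =>
    (triSitePercolation (projIcc (0 : ℝ) 1 zero_le_one r)).real (triOneArm N) with hf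
  set h : ℝ → ℝ := fun r =>
    triLRCrossingProb (projIcc (0 : ℝ) 1 zero_le_one r) (2 * N) N with hh
  set Φ : ℝ → ℝ := fun r => K * h r - Real.log (f r) with hΦ
  have hprojh : projIcc (0 : ℝ) 1 zero_le_one (1 / 2) = half :=
    Subtype.ext (by rw [projIcc_of_mem zero_le_one ⟨by norm_num, by norm_num⟩]; rfl)
  set D : Set ℝ := Icc (1 / 2) (p : ℝ) with hD
  have hIoo : ∀ q ∈ D, q ∈ Ioo (0 : ℝ) 1 := fun q hq => ⟨by linarith [hq.1], hq.2.trans_lt hp1⟩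
  have hval : ∀ q ∈ D, ((projIcc (0 : ℝ) 1 zero_le_one q : unitInterval) : ℝ) = q := fun q hq => by
    rw [projIcc_of_mem zero_le_one ⟨(hIoo q hq).1.le, (hIoo q hq).2.le⟩]
  have hfpos : ∀ q ∈ D, 0 < f q := fun q hq =>
    real_triOneArm_pos (by rw [hval q hq]; exact hq.1) N
  -- derivatives on `D`
  have hderiv : ∀ q ∈ D, HasDerivAt Φ
      (K * paraPivotalSum (projIcc (0 : ℝ) 1 zero_le_one q) N -
        oneArmPivotalSum (projIcc (0 : ℝ) 1 zero_le_one q) N / f q) q := fun q hq =>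
    ((hasDerivAt_triLRCrossingProb_two N (hIoo q hq)).const_mul K).sub
      ((hasDerivAt_real_triOneArm N (hIoo q hq)).log (hfpos q hq).ne')
  have hcont : ContinuousOn Φ D := fun q hq => (hderiv q hq).continuousAt.continuousWithinAt
  have hdiff : DifferentiableOn ℝ Φ (interior D) := fun q hq =>
    (hderiv q (interior_subset hq)).differentiableAt.differentiableWithinAt
  have hnonneg : ∀ q ∈ interior D, 0 ≤ deriv Φ q := by
    intro q hq
    have hqD : q ∈ D := interior_subset hq
    rw [hD, interior_Icc] at hq
    rw [(hderiv q hqD).deriv]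
    set t : unitInterval := projIcc (0 : ℝ) 1 zero_le_one q with ht
    have htq : (t : ℝ) = q := hval q hqD
    have ht1 : 1 / 2 < (t : ℝ) := by rw [htq]; exact hq.1
    have ht2 : t < p := Subtype.coe_lt_coe.1 (by rw [htq]; exact hq.2)
    have hft : f q = (triSitePercolation t).real (triOneArm N) := rfl
    have hb := hpiv t ht1 ht2
    have hfq : 0 < f q := hfpos q hqD
    rw [sub_nonneg, div_le_iff₀ hfq, hft]
    exact hb
  have hmono : MonotoneOn Φ D := monotoneOn_of_deriv_nonneg (convex_Icc _ _) hcont hdiff hnonneg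
  have hpD : (p : ℝ) ∈ D := ⟨hp.le, le_rfl⟩
  have hhD : (1 / 2 : ℝ) ∈ D := ⟨le_rfl, hp.le⟩
  have hΦle := hmono hhD hpD hp.le
  -- unpack `Φ (1/2) ≤ Φ p`
  have hfp : f p = (triSitePercolation p).real (triOneArm N) := by
    simp only [hf, projIcc_val zero_le_one p]
  have hfh : f (1 / 2) = critOneArmProb N := by simp only [hf, hprojh]
  have hhp1 : h p ≤ 1 := measureReal_le_one
  have hhh0 : 0 ≤ h (1 / 2) := measureReal_nonneg
  have hlog : Real.log (f p) ≤ Real.log (f (1 / 2)) + K := by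
    have : K * h (1 / 2) - Real.log (f (1 / 2)) ≤ K * h p - Real.log (f p) := hΦle
    nlinarith [this, hhp1, hhh0, hK]
  have hfp0 : 0 < f p := hfpos _ hpD
  have hfh0 : 0 < f (1 / 2) := hfpos _ hhD
  rw [← hfp, ← hfh, ← Real.exp_log hfp0, ← Real.exp_log hfh0, ← Real.exp_add,
    Real.exp_le_exp]
  linarith

/-- **(A) with (C) imply the one-arm stability below `L(p)`** (Werner 2009, Lecture 6, §5, p. 47,
last display, and p. 48: "It follows that `P_p(0 ↔ ∂Λ_n) ≍ P_{1/2}(0 ↔ ∂Λ_n)` for `n ≤ L(p)`";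
originally Kesten 1987; Nolin 2008, Thm. 27, `j = 1`):
`Werner2009_lemma62P → Werner2009_oneArm_logDeriv → Werner2009_oneArm_nearCritical`. For `ε` below
both thresholds, a common inner radius `r₀` and `p` in a right neighbourhood of `1/2`: for
`n₁ ≤ N ≤ L(p, ε)` and `t ∈ (1/2, p)` one has `N ≤ L(t, ε)` (`charLengthW_antitone`), so (C) and
the lower bound of (A) give `Σ_x P_t(x pivotal for {0 ↔ ∂Λ_N}) ≤ (max C 0 / c) ·
Σ_x P_t(x pivotal for H(N)) · P_t(0 ↔ ∂Λ_N)`, and `real_triOneArm_le_exp_mul_of_pivotal` integrates;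
the finitely many `N < n₁` are absorbed by `exists_pos_le_critOneArmProb`; the lower inequality
holds with constant `1` by monotonicity in `p`. [cite: WernerPCMI2009, Lecture 6, §5 (p. 48, "It follows that P_p(0 ↔ ∂Λ_n) ≍ P_{1/2}(0 ↔ ∂Λ_n) for n ≤ L(p)")] -/
theorem Werner2009_oneArm_nearCritical_of_logDeriv (hA : Werner2009_lemma62P)
    (hC : Werner2009_oneArm_logDeriv) : Werner2009_oneArm_nearCritical := by
  obtain ⟨εA, hεA, hA⟩ := hA
  obtain ⟨εC, hεC, hC⟩ := hC
  refine ⟨min εA εC, lt_min hεA hεC, fun ε hε hεlt => ?_⟩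
  obtain ⟨rA, hrA⟩ := hA hε (hεlt.trans_le (min_le_left _ _))
  obtain ⟨rC, hrC⟩ := hC hε (hεlt.trans_le (min_le_right _ _))
  obtain ⟨nA, δA, hδA, cA, hcA, CA, hbA⟩ := hrA (max rA rC) (le_max_left _ _)
  obtain ⟨nC, δC, hδC, CC, hbC⟩ := hrC (max rA rC) (le_max_right _ _)
  obtain ⟨m, hm, hmle⟩ := exists_pos_le_critOneArmProb (max nA nC)
  set K : ℝ := max CC 0 / cA with hKdef
  have hK : 0 ≤ K := div_nonneg (le_max_right _ _) hcA.le
  refine ⟨min (min δA δC) (1 / 4), lt_min (lt_min hδA hδC) (by norm_num), 1, one_pos,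
    max (Real.exp K) m⁻¹, fun p hp1 hp2 N hNL => ⟨?_, ?_⟩⟩
  · -- lower inequality: monotonicity in `p`
    rw [one_mul]
    exact critOneArmProb_le_real_triOneArm
      (Subtype.coe_le_coe.1 (by rw [coe_half]; exact hp1.le)) N
  · have hpA : (p : ℝ) < 1 / 2 + δA :=
      hp2.trans_le (by gcongr; exact (min_le_left _ _).trans (min_le_left _ _))
    have hpC : (p : ℝ) < 1 / 2 + δC :=
      hp2.trans_le (by gcongr; exact (min_le_left _ _).trans (min_le_right _ _))
    have hp1' : (p : ℝ) < 1 := by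
      have : (p : ℝ) < 1 / 2 + 1 / 4 := hp2.trans_le (by gcongr; exact min_le_right _ _)
      linarith
    have hπ0 : 0 ≤ critOneArmProb N := measureReal_nonneg
    rcases lt_or_ge N (max nA nC) with hNlt | hNge
    · -- finitely many small scales
      calc (triSitePercolation p).real (triOneArm N) ≤ 1 := measureReal_le_one
        _ ≤ m⁻¹ * critOneArmProb N := by
            rw [← div_eq_inv_mul, le_div_iff₀ hm, one_mul]; exact hmle N hNlt
        _ ≤ max (Real.exp K) m⁻¹ * critOneArmProb N := by gcongr; exact le_max_right _ _
    · -- scales `n₁ ≤ N ≤ L(p, ε)`: integrate the differential inequality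
      have hmain : (triSitePercolation p).real (triOneArm N) ≤ Real.exp K * critOneArmProb N := by
        refine real_triOneArm_le_exp_mul_of_pivotal hp1 hp1' hK fun t ht1 htp => ?_
        have htp' : (t : ℝ) < p := Subtype.coe_lt_coe.2 htp
        have htA : (t : ℝ) < 1 / 2 + δA := htp'.trans hpA
        have htC : (t : ℝ) < 1 / 2 + δC := htp'.trans hpC
        have hNt : N ≤ charLengthW ε t := (hNL).trans (charLengthW_antitone hε ht1 htp.le)
        have hA1 := (hbA t ht1.le htA N ((le_max_left _ _).trans hNge) fun _ => hNt).1
        have hC1 := hbC t ht1.le htC N ((le_max_right _ _).trans hNge) fun _ => hNt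
        have hP0 : 0 ≤ (triSitePercolation t).real (triOneArm N) := measureReal_nonneg
        have hX0 : 0 ≤ (N : ℝ) ^ 2 * fourArmProbAt t (max rA rC) N :=
          mul_nonneg (sq_nonneg _) (fourArmProbAt_nonneg _ _ _)
        have hX : (N : ℝ) ^ 2 * fourArmProbAt t (max rA rC) N ≤ paraPivotalSum t N / cA := by
          rw [le_div_iff₀ hcA, mul_comm]; exact hA1
        calc oneArmPivotalSum t N
            ≤ CC * ((N : ℝ) ^ 2 * fourArmProbAt t (max rA rC) N) *
                (triSitePercolation t).real (triOneArm N) := hC1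
          _ ≤ max CC 0 * ((N : ℝ) ^ 2 * fourArmProbAt t (max rA rC) N) *
                (triSitePercolation t).real (triOneArm N) := by
              gcongr; exact le_max_left _ _
          _ ≤ max CC 0 * (paraPivotalSum t N / cA) *
                (triSitePercolation t).real (triOneArm N) := by gcongr
          _ = K * paraPivotalSum t N * (triSitePercolation t).real (triOneArm N) := by
              rw [hKdef]; ring
      exact hmain.trans (by gcongr; exact le_max_left _ _)

/-! ### The assembly from the five printed lemmas -/

/-- **crit-perc.S16 from five printed lemmas** (Smirnov–Werner 2001, §2, Thm. 1 (i) of the arXiv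
version, "It has been shown by Kesten … that all these results hold provided that …
`P[A¹_R] = R^{-5/48+o(1)}` and `P[A²_R] = R^{-5/4+o(1)}`"; Werner 2009, Lecture 6, Thm. 6.1 and
"End of the proof of the theorem"): `θ(p) = (p - 1/2)^{5/36 + o(1)}` as `p ↓ 1/2`
(`triTheta_exponent`) follows from the critical one-arm exponent `5/48` (`oneArm_exponent`), the
critical four-arm exponent `5/4` (`fourArm_exponent`), Werner's Lemma 6.2 (`Werner2009_lemma62P`),
Lemma 6.3 (`Werner2009_lemma63`) and the one-arm differential inequality
(`Werner2009_oneArm_logDeriv`) — through `Werner2009_lemma62W_of_lemma62P_of_lemma63`,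
`Werner2009_oneArm_nearCritical_of_logDeriv` and `triTheta_exponent_of_leavesW`; everything else
(Russo's formula, Cor. 6.3, Kesten's relation, `L(p, ε) → ∞`, the exponential decay above `L(p)`,
`θ(p) ≍ P_{1/2}(0 ↔ ∂Λ_{L(p)})`, Cor. 6.4, Lemma 6.4 and the bookkeeping of exponents) is proved
in the tree. [cite: SmirnovWernerMRL2001, §2, Thm. 1 (i) and the paragraph following it] [cite: WernerPCMI2009, Lecture 6, Thm. 6.1 and "End of the proof of the theorem"] -/
theorem triTheta_exponent_of_leavesP (h₁ : oneArm_exponent) (h₄ : fourArm_exponent)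
    (hA : Werner2009_lemma62P) (hB : Werner2009_lemma63) (hC : Werner2009_oneArm_logDeriv) :
    triTheta_exponent :=
  triTheta_exponent_of_leavesW h₁ h₄ (Werner2009_lemma62W_of_lemma62P_of_lemma63 hA hB)
    (Werner2009_oneArm_nearCritical_of_logDeriv hA hC)

end Literature.Probability.Percolation
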